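import Summits.BirchSwinnertonDyer.BirchSwinnertonDyer.Theorems.ResidualThetaTransportAtTwoRlfTwistedPlusLocShift
import Summits.BirchSwinnertonDyer.BirchSwinnertonDyer.Theorems.ResidualThetaTransportAtTwoRlfTwistedPlusCoinvOfHonda
import Summits.BirchSwinnertonDyer.BirchSwinnertonDyer.Theorems.ThetaPartnerAtTwoSignedControlAtTwoPlusLocEngine
import HarnessLib

/-!
# Road T for item 23110, brick (R3) = (T2)⁺ part 2: the TWISTED LOC ENGINE — the `χ_u`-twisted `±`-local lift at a place above
# `p` from the twisted coinvariants «`((A ⊗ ℚ_p/ℤ_p)(χ_u))_Γ = 0`»; at `p = 2` for Kobayashi's `A = ⋃ₙ E⁺(ℚ_{2,n})`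
# UNCONDITIONALLY (GoodSS, `a₂ = 0`), by `plusCoinvariantsDivTwisted_two`

Route `ResidualThetaTransportAtTwo` (RTT, crux r201 `ResidualLambdaFormulaNegDiscAtTwo`, stmt-BirchSwinnertonDyer-23110) /
`ThetaPartnerAtTwo` (TP2). Seat `prover-bsd-wall-tp2-p2x-w3` g12; `--supports stmt-BirchSwinnertonDyer-23110`. THEOREMS ONLY (no
definition, no named fact, no `sorry`); route-independent; closes nothing.

The `χ_u`-twin of K4's `SignedEC.exists_localLift_kummer_of_coinvariantsDiv` (`…PlusLocEngine`, Step A) on top of the twisted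
part 7 `exists_twistedTorsion_localLift_kummer_of_shift` (`…RlfTwistedPlusLocShift`, this seat):

* `exists_twistedTorsion_localLift_kummer_of_coinvariantsDivTwisted` — any number field `K`, `W/K`, prime `p`, `ℤ_p`-extension `κ`,
  field `E/K` with `g ∈ Γ_E` restricting to the topological generator, `E(E) ≤ A ≤ E(K_∞·E)` in the sense `A ≤ localTowerPointsOfEmb`,
  `u ≡ 1 (mod p)`: if (DIV_{A,u}) «`∀ x ∈ A, ∀ k, ∃ y ∈ A, j, w ∈ E(K_∞·E): p^j x − p^k (u·g y − y) = p^{j+k} w`» then every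
  `t ∈ H¹(K_∞, E[p^∞])` with `u·conj_{g|} t − t` Kummer-from-`A` admits `J₀` such that for every `J ≥ J₀` some
  `x ∈ H¹(Γ_E, E[p^J](χ_u))` has «`res_E y = x ⇒ t − twistedTorsionToH1 y` Kummer-from-`A`» for all global `y ∈ H¹(Γ_K, E[p^J](χ_u))`.
  Step A with the twist: the Kummer datum `(Q, k)` of `u·conj_g t − t` (the scalar `u` passes through `oneCocycleClassₗ`/`map_zsmul`),
  (DIV_{A,u}) at `x' = p^{k'} Q'`, a `p^j`-th root `S` of `y`: `f₁ = f₀ − ∂S` satisfies `u·g f₁(g⁻¹τg) − f₁(τ) = ∂T` with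
  `T = Q' − (u·g S − S) − w` torsion.
* `exists_twistedTorsion_localLift_plusKummer_two` — `K = ℚ`, `p = 2`, `W` globally minimal with `GoodSS W 2`, `a₂ = 0`, cyclotomic
  `κ`, the place `v ∋ 2`, `g ∈ Γ_{ℚ_v}` restricting to the topological generator, `u` odd, `A = ⋃ₙ E⁺(ℚ_{2,n})`: (DIV_{A,u}) is the
  theorem `plusCoinvariantsDivTwisted_two` (HONDA⁺@2), so the twisted `+`-local lift at `2` holds UNCONDITIONALLY — (R3) = (T2)⁺ of the
  lead's memo, in the (TCAS-K) currency.

HONEST FRAMING: closes nothing; (R1), (R2), (R5), (R6) untouched; 23110 is NOT proved; BSD is not proved by any of this.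
References: [GreenbergLNM1716] §4 Lemma 4.7 (pp. 107–108), p. 124; [BDKim2013] Props. 2.2–2.3, proof of Cor. 3.15;
[Kobayashi2003] Def. 1.1, §8.4; [SerreGaloisCohomology1997] I §5.8.
-/

set_option autoImplicit false
-- the Theorems namespace of this sub repeats the summit name by design (D-0017 nested layout)
set_option linter.dupNamespace false

noncomputable section

open scoped Classical NumberField

open NumberField IsDedekindDomain CategoryTheory

universe u

namespace Summit.BirchSwinnertonDyer.BirchSwinnertonDyer.Theorems.SignedEC.TwistedLocalDescent

open Literature.NumberTheory.EllipticCurves Literature.NumberTheory.GaloisRepresentations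
  WeierstrassCurve ZpExtension Literature.NumberTheory.EllipticCurves.Kobayashi2003
  Literature.NumberTheory.EllipticCurves.Sprung2012

/-! ## §1 The twisted engine -/

section Engine

variable {K : Type u} [Field K] [NumberField K] (W : WeierstrassCurve K) [W.IsElliptic] {p : ℕ} [Fact p.Prime]
  (κ : ZpExtension K p) (E : Type u) [Field E] [Algebra K E]

set_option maxHeartbeats 3200000 in
/-- **The twisted LOC engine** (`χ_u`-twin of `SignedEC.exists_localLift_kummer_of_coinvariantsDiv`): (DIV_{A,u}) ⇒ for every
`t ∈ H¹(K_∞, E[p^∞])` with `u·conj_{g|} t − t` Kummer-from-`A`, eventually in `J` some `x ∈ H¹(Γ_E, E[p^J](χ_u))` has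
«`res_E y = x ⇒ t − twistedTorsionToH1 y` Kummer-from-`A`». See the module docstring for Step A; Steps B–D are
`exists_twistedTorsion_localLift_kummer_of_shift`. [cite: GreenbergLNM1716, §4 Lemma 4.7 (pp. 107–108), p. 124]
[cite: BDKim2013, Props. 2.2–2.3] -/
theorem exists_twistedTorsion_localLift_kummer_of_coinvariantsDivTwisted
    (A : AddSubgroup (localPoints W E))
    (hAM : A ≤ localTowerPointsOfEmb κ (closureEmb (K := K) E) W)
    {g : Field.absoluteGaloisGroup E} (hg : κ.IsTopGenerator (resGal (K := K) E g))
    {u : ℤ} (hu : (p : ℤ) ∣ u - 1)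
    (hdiv : ∀ x ∈ A, ∀ k : ℕ, ∃ y ∈ A, ∃ j : ℕ, ∃ w ∈ localTowerPointsOfEmb κ (closureEmb (K := K) E) W,
      p ^ j • x - p ^ k • (u • g • y - y) = p ^ (j + k) • w)
    (t : W.subgroupH1 p κ.kerSubgroup)
    (ht : u • W.conjH1 p κ.kerSubgroup (resGal (K := K) E g) t - t ∈
      localKummerOverOfEmb W p κ.kerSubgroup (closureEmb (K := K) E) A) :
    ∃ J₀ : ℕ, ∀ J : ℕ, J₀ ≤ J →
      ∃ x : galoisCohomology ((W.twistedTorsionGaloisModule p κ J u hu).restrictField E) 1,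
        ∀ y : galoisCohomology (W.twistedTorsionGaloisModule p κ J u hu) 1,
          galoisCohomology.res (W.twistedTorsionGaloisModule p κ J u hu) E 1 y = x →
          t - W.twistedTorsionToH1 p κ J u hu y ∈ localKummerOverOfEmb W p κ.kerSubgroup (closureEmb (K := K) E) A := by
  -- notation and generalities (as in the untwisted engine)
  set ι : AlgebraicClosure K →ₐ[K] AlgebraicClosure E := closureEmb (K := K) E with hι
  set M : AddSubgroup (localPoints W E) := localTowerPointsOfEmb κ ι W with hM
  have hMfix : ∀ {P : localPoints W E}, P ∈ M →
      ∀ τ : Field.absoluteGaloisGroup E, τ ∈ localSubgroupOfEmb κ.kerSubgroup ι → τ • P = P :=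
    fun {P} hP ↦ (mem_localTowerPointsOfEmb_iff κ ι W P).1 hP
  have hconj : ∀ (σ τ : Field.absoluteGaloisGroup E), τ ∈ localSubgroupOfEmb κ.kerSubgroup ι →
      σ⁻¹ * τ * σ ∈ localSubgroupOfEmb κ.kerSubgroup ι := by
    intro σ τ hτ
    rw [mem_localSubgroupOfEmb_iff] at hτ ⊢
    rw [map_mul, map_mul, map_inv]
    exact κ.kerSubgroup_normal.conj_mem' _ hτ _
  have hGmem : ∀ {u : Field.absoluteGaloisGroup E}, u ∈ localSubgroupOfEmb κ.kerSubgroup ι →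
      resGalOfEmb ι u ∈ κ.kerSubgroup := fun {u} hu ↦ (mem_localSubgroupOfEmb_iff _ ι u).1 hu
  have galois_smul_nsmul : ∀ (τ : Field.absoluteGaloisGroup E) (n : ℕ) (P : localPoints W E),
      τ • (n • P) = n • (τ • P) := fun τ n P ↦ map_nsmul (DistribSMul.toAddMonoidHom (localPoints W E) τ) n P
  have galois_smul_zsmul : ∀ (τ : Field.absoluteGaloisGroup E) (n : ℤ) (P : localPoints W E),
      τ • (n • P) = n • (τ • P) := fun τ n P ↦ map_zsmul (DistribSMul.toAddMonoidHom (localPoints W E) τ) n P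
  -- Step 0: a cocycle `φ` of `t`; its local values `f0` on `G_∞`
  obtain ⟨φ, rfl⟩ := oneCocycleClass_surjective (discreteTopRep κ.kerSubgroup (W.geomPrimaryTorsion p)) t
  obtain ⟨f0, hf0⟩ : ∃ f0 : ∀ u : Field.absoluteGaloisGroup E, u ∈ localSubgroupOfEmb κ.kerSubgroup ι →
      localPoints W E, ∀ u hu, f0 u hu =
      pointsMapOfEmb W ι ((φ.1 ⟨resGalOfEmb ι u, hGmem hu⟩ : W.geomPrimaryTorsion p) : W.geomPoints) :=
    ⟨_, fun _ _ ↦ rfl⟩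
  -- Step A: unpack `u·conj_γ t − t ∈ Kummer(A)` (γ = res g) at the cocycle level
  let φg : contOneCocycles (discreteTopRep κ.kerSubgroup (W.geomPrimaryTorsion p)) :=
    contOneCocycles.pullback (subgroupConj κ.kerSubgroup (resGalOfEmb ι g))
      (resHomOfEquivariant (subgroupConj κ.kerSubgroup (resGalOfEmb ι g))
        (DistribSMul.toAddMonoidHom (W.geomPrimaryTorsion p) (resGalOfEmb ι g))
        (ZpExtension.conj_compat κ.kerSubgroup (resGalOfEmb ι g))) φ
  have hconjφ : W.conjH1 p κ.kerSubgroup (resGal (K := K) E g) (oneCocycleClass _ φ) = oneCocycleClass _ φg :=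
    map_oneCocycleClass _ _ _ φ
  have hzs : u • oneCocycleClass (discreteTopRep κ.kerSubgroup (W.geomPrimaryTorsion p)) φg =
      oneCocycleClass _ (u • φg) := by
    rw [← oneCocycleClassₗ_apply (φ := φg), ← map_zsmul, oneCocycleClassₗ_apply]
  rw [hconjφ, hzs, ← oneCocycleClass_sub] at ht
  obtain ⟨ψ, Q, k, hψ, hQA, hcob⟩ := ht
  have hψ0 : oneCocycleClass (discreteTopRep κ.kerSubgroup (W.geomPrimaryTorsion p)) (ψ - (u • φg - φ)) = 0 := by
    rw [oneCocycleClass_sub, sub_eq_zero]; exact hψ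
  rw [oneCocycleClass_eq_zero_iff] at hψ0
  obtain ⟨R₀, hR₀⟩ := hψ0
  -- `ψ h = (u·γ φ(γ⁻¹ h γ) − φ h) + (h R₀ − R₀)` for `h ∈ ker κ`
  have hψφ : ∀ h : κ.kerSubgroup, (ψ.1 h : W.geomPrimaryTorsion p) =
      (u • (resGalOfEmb ι g • φ.1 (subgroupConj κ.kerSubgroup (resGalOfEmb ι g) h)) - φ.1 h) +
        ((h : Field.absoluteGaloisGroup K) • R₀ - R₀) := by
    intro h
    have h1 := hR₀ h
    rw [Submodule.coe_sub, ContinuousMap.sub_apply, Submodule.coe_sub, ContinuousMap.sub_apply, Submodule.coe_smul,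
      ContinuousMap.smul_apply, contOneCocycles.pullback_apply, sub_eq_iff_eq_add, discreteTopRep_ρ_apply,
      Subgroup.smul_def] at h1
    rw [h1, add_comm]
    rfl
  -- on `G_∞`: `u·g f0 (g⁻¹ τ g) − f0 τ = τ Q' − Q'` with `Q' = Q − ι R₀`
  have hgconj_mem : ∀ {τ : Field.absoluteGaloisGroup E}, τ ∈ localSubgroupOfEmb κ.kerSubgroup ι →
      g⁻¹ * τ * g ∈ localSubgroupOfEmb κ.kerSubgroup ι := fun {τ} hτ ↦ hconj g τ hτ
  obtain ⟨R₀', hR₀'⟩ : ∃ R₀' : localPoints W E,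
      R₀' = pointsMapOfEmb W ι ((R₀ : W.geomPrimaryTorsion p) : W.geomPoints) := ⟨_, rfl⟩
  obtain ⟨Q', hQ'⟩ : ∃ Q' : localPoints W E, Q' = Q - R₀' := ⟨_, rfl⟩
  have hA1 : ∀ (τ : Field.absoluteGaloisGroup E) (hτ : τ ∈ localSubgroupOfEmb κ.kerSubgroup ι),
      u • g • f0 (g⁻¹ * τ * g) (hgconj_mem hτ) - f0 τ hτ = τ • Q' - Q' := by
    intro τ hτ
    have h1 := hcob ⟨τ, hτ⟩
    change pointsMapOfEmb W ι _ = τ • Q - Q at h1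
    have h2 := hψφ (resGalSubgroupOfEmb κ.kerSubgroup ι ⟨τ, hτ⟩)
    have hsc : (subgroupConj κ.kerSubgroup (resGalOfEmb ι g) (resGalSubgroupOfEmb κ.kerSubgroup ι ⟨τ, hτ⟩) :
        κ.kerSubgroup) = ⟨resGalOfEmb ι (g⁻¹ * τ * g), hGmem (hgconj_mem hτ)⟩ := by
      apply Subtype.ext
      show _ = resGalOfEmb ι (g⁻¹ * τ * g)
      rw [subgroupConj_apply_coe, resGalSubgroupOfEmb_apply_coe, map_mul, map_mul, map_inv]
    have hre : (resGalSubgroupOfEmb κ.kerSubgroup ι ⟨τ, hτ⟩ : κ.kerSubgroup) =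
        ⟨resGalOfEmb ι τ, hGmem hτ⟩ := rfl
    rw [hsc, hre] at h2
    have h3 := congrArg (fun z : W.geomPrimaryTorsion p ↦ pointsMapOfEmb W ι (z : W.geomPoints)) h2
    simp only at h3
    rw [hre] at h1
    rw [h1, AddSubgroup.coe_add, map_add, AddSubgroup.coe_sub, map_sub, AddSubgroup.coe_sub, map_sub,
      AddSubgroupClass.coe_zsmul, map_zsmul, primaryComponent.coe_smul, pointsMapOfEmb_smul,
      primaryComponent.coe_smul, pointsMapOfEmb_smul, ← hf0 _ (hgconj_mem hτ), ← hf0 τ hτ, ← hR₀'] at h3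
    -- `h3 : τ Q − Q = (u·g f0 (g⁻¹τg) − f0 τ) + (τ R₀' − R₀')`
    rw [hQ', smul_sub]
    have h4 : u • g • f0 (g⁻¹ * τ * g) (hgconj_mem hτ) - f0 τ hτ = (τ • Q - Q) - (τ • R₀' - R₀') := by
      rw [h3]; abel
    rw [h4]; abel
  -- a power of `p` killing `R₀`; `k' = k + m₀`, `x' = p^{k'} Q' = p^{m₀} (p^k Q) ∈ A`
  obtain ⟨m₀, hm₀⟩ : ∃ m₀ : ℕ, p ^ m₀ • R₀ = 0 := by
    obtain ⟨m₀, hm⟩ := AddCommGroup.mem_primaryComponent.mp R₀.2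
    exact ⟨m₀, Subtype.ext (by rw [AddSubmonoidClass.coe_nsmul, hm, ZeroMemClass.coe_zero])⟩
  have hR₀'tors : p ^ m₀ • R₀' = 0 := by
    rw [hR₀', ← map_nsmul, ← AddSubmonoidClass.coe_nsmul, hm₀, ZeroMemClass.coe_zero, map_zero]
  obtain ⟨k', hk'⟩ : ∃ k' : ℕ, k' = k + m₀ := ⟨_, rfl⟩
  obtain ⟨x', hx'⟩ : ∃ x' : localPoints W E, x' = p ^ k' • Q' := ⟨_, rfl⟩
  have hx'eq : x' = p ^ m₀ • (p ^ k • Q) := by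
    have e1 : p ^ k' • R₀' = 0 := by rw [hk', pow_add, mul_smul, hR₀'tors, smul_zero]
    rw [hx', hQ', smul_sub, e1, sub_zero, hk', pow_add, mul_comm, mul_smul]
  have hx'A : x' ∈ A := by rw [hx'eq]; exact AddSubgroup.nsmul_mem _ hQA _
  -- (DIV_{A,u}) at `x'`, `k'`: `p^j x' − p^{k'} (u·g y − y) = p^{j+k'} w`
  obtain ⟨y, hyA, j, w, hwM, hdiv'⟩ := hdiv x' hx'A k'
  -- a `p^j`-th root `S` of `y`, and the torsion point `T = Q' − (u·g S − S) − w`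
  obtain ⟨S, hS⟩ := W.nsmul_surjective_localPoints E (pow_ne_zero j (Fact.out : p.Prime).ne_zero) y
  simp only at hS
  obtain ⟨T, hT⟩ : ∃ T : localPoints W E, T = Q' - (u • g • S - S) - w := ⟨_, rfl⟩
  have hTtors : p ^ (j + k') • T = 0 := by
    have e1 : p ^ (j + k') • Q' = p ^ j • x' := by rw [hx', pow_add, mul_smul]
    have e2 : p ^ (j + k') • (u • g • S - S) = p ^ k' • (u • g • y - y) := by
      rw [pow_add, mul_comm, mul_smul, smul_sub (p ^ j), smul_comm (p ^ j) u (g • S), smul_comm (p ^ j) g S, hS]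
    rw [hT, smul_sub, smul_sub, e1, e2, hdiv', sub_self]
  -- (iii) twisted `g`-invariance up to the coboundary of the torsion point `T`
  have hf1conj : ∀ (τ : Field.absoluteGaloisGroup E) (hτ : τ ∈ localSubgroupOfEmb κ.kerSubgroup ι),
      u • g • (f0 (g⁻¹ * τ * g) (hgconj_mem hτ) - ((g⁻¹ * τ * g) • S - S)) - (f0 τ hτ - (τ • S - S)) =
        τ • T - T := by
    intro τ hτ
    have e1 : g • ((g⁻¹ * τ * g) • S - S) = τ • g • S - g • S := by
      rw [smul_sub, ← mul_smul, show g * (g⁻¹ * τ * g) = τ * g by group, mul_smul]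
    have e2 : τ • w = w := hMfix hwM τ hτ
    have e3 := hA1 τ hτ
    have e4 : τ • T - T = (τ • Q' - Q') - ((τ • (u • g • S) - u • g • S) - (τ • S - S)) := by
      rw [hT, smul_sub, smul_sub, smul_sub, e2]; abel
    rw [smul_sub g, e1, smul_sub u, smul_sub u, ← galois_smul_zsmul τ u (g • S), e4, ← e3]
    abel
  -- Steps B–D
  exact exists_twistedTorsion_localLift_kummer_of_shift W κ E A hAM hg hu φ S T ⟨j, by rw [hS]; exact hyA⟩
    ⟨j + k', hTtors⟩ fun τ τ' hτ' ↦ by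
      have e : τ' = ⟨g⁻¹ * τ * g, hgconj_mem τ.2⟩ := Subtype.ext hτ'
      subst e
      have h := hf1conj τ.1 τ.2
      rw [hf0 _ (hgconj_mem τ.2), hf0 τ.1 τ.2] at h
      exact h

end Engine

/-! ## §2 `p = 2`: the twisted `+`-local lift at the place above `2`, UNCONDITIONALLY -/

section Two

variable (W : WeierstrassCurve ℚ) [W.IsElliptic] [W.IsGloballyMinimal] (κ : ZpExtension ℚ 2)

/-- **(R3) = (T2)⁺ at `p = 2`, unconditionally.** `W/ℚ` globally minimal with `GoodSS W 2` and `a₂(W) = 0`; `κ` cyclotomic;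
`v ∋ 2`; `g ∈ Γ_{ℚ_v}` restricting to the topological generator of `Gal(ℚ_∞/ℚ)` (`2` is totally ramified:
`ZpExtension.IsCyclotomic.exists_isTopGenerator_resGalOfEmb_adicCompletion`); `u` odd; `A = ⋃ₙ E⁺(ℚ_{2,n})`. Every
`t ∈ H¹(ℚ_∞, E[2^∞])` whose twisted coboundary `u·conj_{g|} t − t` is `+`-Kummer at `v` admits `J₀` such that for every `J ≥ J₀`
some `x ∈ H¹(Γ_{ℚ_v}, E[2^J](χ_u))` satisfies: for every global `y ∈ H¹(Γ_ℚ, E[2^J](χ_u))` with `res_v y = x`,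
`t − twistedTorsionToH1 y` is `+`-Kummer at `v`. (DIV_{A,u}) is `plusCoinvariantsDivTwisted_two` (HONDA⁺@2).
[cite: GreenbergLNM1716, §4 Lemma 4.7 (pp. 107–108), p. 124] [cite: BDKim2013, Props. 2.2–2.3] [cite: Kobayashi2003, §8.4] -/
theorem exists_twistedTorsion_localLift_plusKummer_two (hss : Rank1Residual.GoodSS W 2) (ha : W.frobeniusTrace 2 = 0)
    (hκ : κ.IsCyclotomic) (v : HeightOneSpectrum (𝓞 ℚ)) (hv : (2 : 𝓞 ℚ) ∈ v.asIdeal)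
    {g : Field.absoluteGaloisGroup (v.adicCompletion ℚ)} (hg : κ.IsTopGenerator (resGal (K := ℚ) (v.adicCompletion ℚ) g))
    {u : ℤ} (hu : (2 : ℤ) ∣ u - 1) (t : W.subgroupH1 2 κ.kerSubgroup)
    (ht : u • W.conjH1 2 κ.kerSubgroup (resGal (K := ℚ) (v.adicCompletion ℚ) g) t - t ∈
      localKummerOverOfEmb W 2 κ.kerSubgroup (closureEmb (K := ℚ) (v.adicCompletion ℚ))
        (⨆ n, signedLocalPoints κ (v.adicCompletion ℚ) W 1 n)) :
    ∃ J₀ : ℕ, ∀ J : ℕ, J₀ ≤ J →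
      ∃ x : galoisCohomology ((W.twistedTorsionGaloisModule 2 κ J u (by exact_mod_cast hu)).restrictField
          (v.adicCompletion ℚ)) 1,
        ∀ y : galoisCohomology (W.twistedTorsionGaloisModule 2 κ J u (by exact_mod_cast hu)) 1,
          galoisCohomology.res (W.twistedTorsionGaloisModule 2 κ J u (by exact_mod_cast hu)) (v.adicCompletion ℚ) 1 y = x →
          t - W.twistedTorsionToH1 2 κ J u (by exact_mod_cast hu) y ∈
            localKummerOverOfEmb W 2 κ.kerSubgroup (closureEmb (K := ℚ) (v.adicCompletion ℚ))
              (⨆ n, signedLocalPoints κ (v.adicCompletion ℚ) W 1 n) := by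
  have hAM := iSup_signedLocalPointsOfEmb_le_localTowerPointsOfEmb W κ 1 (closureEmb (K := ℚ) (v.adicCompletion ℚ))
  have hg' : κ.IsTopGenerator (resGalOfEmb (closureEmb (K := ℚ) (v.adicCompletion ℚ)) g) := hg
  have hDIV := plusCoinvariantsDivTwisted_two W hss ha hκ v hv hg' hu
  refine exists_twistedTorsion_localLift_kummer_of_coinvariantsDivTwisted W κ (v.adicCompletion ℚ)
    (⨆ n, signedLocalPoints κ (v.adicCompletion ℚ) W 1 n) hAM hg (by exact_mod_cast hu) ?_ t ht
  intro x hx k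
  obtain ⟨y, hy, w, hw, h⟩ := hDIV x hx k
  exact ⟨y, hy, k, w, hAM hw, h⟩

end Two

end Summit.BirchSwinnertonDyer.BirchSwinnertonDyer.Theorems.SignedEC.TwistedLocalDescent

end
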